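import Summits.QuantumFields.BalabanUV.T4Continuum.Spine.NE7.QLaCurvedAveragingL1
import Summits.QuantumFields.BalabanUV.T4Continuum.Spine.NE7.QLaFlatAveragingLip

/-!
# Spine/NE7/QLaCurvedAveragingLip — [Balaban1985Averaging] Prop. 5 (156) AT A GENERAL REGULAR BACKGROUND, ℓ¹ form, continued:
# the TWO-SIDED one-bond Lipschitz bound (= clause (ii) of the torus-side shape `FramedBondLip`, file 12, in the B7 fold's
# coordinates at a curved background) and the PRINTED NORMALISATION «(156) + (138) summed» for `Q_k(U₀, ηA)`

Cell `pub-balaban-gaps` (YM blitz Y1, track G2, seat `ne7`, generation 5); text of record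
`run/shared/lean/pub/pub-balaban-gaps/ne/NE7.md` v5 §4sexies (iii).  Sixteenth `Spine/NE7/` file; sequel of file 13
`QLaCurvedAveragingL1` (p350381; one-sided ℓ¹ bound in `B`-variables) doing for the curved background what file 14
`QLaFlatAveragingLip` (§1) and file 11 `QLaFlatAveragingL1` (§5) did for the flat one.

WHAT THIS FILE PROVES (kernel, 0 sorry; B7 fold's concrete `logCovIter` on `ℤ^d`, p06's regime of `B7Prop5General` verbatim):
* §1 `norm_logCovIter_sub_le_one_bond` — for `B, B′` in the polydisc `sup ‖·‖ ≤ b` agreeing off ONE fine bond `⟨y, y+e_μ⟩`, at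
  every coarse bond `c`: `‖Q_k(U₀,B′)(c) − Q_k(U₀,B)(c)‖ ≤ ((1 + θ)L^k + C₃(L^k)²b)·L^{−kd}·‖B′_{yμ} − B_{yμ}‖`
  (`θ = thetaGen d L α₀` = print's `2C′₁α₀`) — p06's per-bond line derivative `prop5_general_156` integrated along
  `t ↦ B + t(B′ − B)`, inside the polydisc by convexity; `logCovIter_eq_of_agree_off_bond_not_bondIn` (locality).
* §2 `norm_logCovIter_le_l1_printed` — printed variables `A` on the `η = L^{−k}`-lattice, `sup|A| ≤ a`, p06's printed-variable
  smallness (`hsmallA`, `hc₃A`, `h155A` = `B7Prop5General`'s §4 hypotheses): `‖Q_k(U₀, ηA)(c)‖ ≤ (1 + 2C′₁α₀ + C₃a)·Σ_b η^d‖A_b‖`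
  — the printed per-entry constant of (156) times the `η^d`-weighted ℓ¹ norm of `A`, i.e. (156) with (138) summed from the
  background, at a GENERAL regular background.

HONEST FRAMING.  As file 13: a theorem about the B7 fold's concrete model of (15)∕(89)∕(127) at a general regular background on
`ℤ^d` (p06's DIVERGENCES inherited: `‖1‖ = 1`, `AvgClosed` structure group, corner blocks, `t ∈ ℂ` lines, admissible non-optimal
constants); it is NOT the averaging of record of the T⁴ chain (B12 (0.4), centred — NE7.md R45); no torus, no (158) domains;
nothing of the paper asserted beyond what p06∕r04 proved.  [folklore] bookkeeping; (QL-a) NOT IN PRINT; NE7 NOT proved;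
spine 0∕9; fixed finite T⁴ — NOT ℝ⁴, NOT infinite volume, NOT a mass gap, NOT Clay.
-/

noncomputable section

open scoped BigOperators
open NormedSpace Finset Set

namespace Summit.QuantumFields.BalabanUV.T4Continuum.Spine.NE7.B7Curved

open Literature.MathematicalPhysics.QuantumFieldTheory.Balaban1983to89.B7Prop1Explicit (Site e expUnit val_expUnit)
open Literature.MathematicalPhysics.QuantumFieldTheory.Balaban1983to89.B7Prop1Local (InBox AgreeOn loK bondHiK)
open Literature.MathematicalPhysics.QuantumFieldTheory.Balaban1983to89.B7Prop2Explicit (pdev AvgClosed C0 c2')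
open Literature.MathematicalPhysics.QuantumFieldTheory.Balaban1983to89.B7Prop3Flat (c3)
open Literature.MathematicalPhysics.QuantumFieldTheory.Balaban1983to89.B7Prop4GeneralLevels (logCovIter linCovIter)
open Literature.MathematicalPhysics.QuantumFieldTheory.Balaban1983to89.B7LocalityGeneral (logCovIter_congr)
open Literature.MathematicalPhysics.QuantumFieldTheory.Balaban1983to89.B7Prop5GeneralInduction (dCov)
open Literature.MathematicalPhysics.QuantumFieldTheory.Balaban1983to89.B7Prop5GeneralLevels (thetaGen C3Gen C1ppGen)
open Literature.MathematicalPhysics.QuantumFieldTheory.Balaban1983to89.B7Prop5General (prop5_general_156)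
open Literature.MathematicalPhysics.QuantumFieldTheory.Balaban1983to89.B7Prop5Flat (BondIn bump bump_eq_zero_of norm_real_smul)
open Summit.QuantumFields.BalabanUV.T4Continuum.Spine.NE7.B7Flat (hasDerivAt_comp_ofReal hasDerivAt_of_shift
  eq_add_bump_of_agree_off_bond)

variable {d : ℕ}
variable {𝔸 : Type*} [NormedRing 𝔸] [NormedAlgebra ℂ 𝔸] [CompleteSpace 𝔸] [NormOneClass 𝔸]

section Regime

/-! ## §0 The regime (p06's section variables, verbatim, as in file 13) -/

variable (L : ℕ) (hL : 2 ≤ L) {G : Subgroup 𝔸ˣ} (hG : AvgClosed d L G) (k : ℕ)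
  (U₀ : Site d → Fin d → 𝔸ˣ) (hU₀ : ∀ x κ, U₀ x κ ∈ G) {α₀ : ℝ} (hα : 0 < α₀)
  (hα3 : C0 d * α₀ ≤ 1 / 3) (hα4 : 4 * α₀ ≤ c2' d L) (h52 : pdev U₀ < α₀ * (((L : ℝ) ^ k)⁻¹) ^ 2)
  {b : ℝ} (hb : 0 ≤ b)
  (hsmall : Real.exp (4 * (800 * ((d : ℝ) + 1) ^ 2 * ((d : ℝ) + 4)) * α₀)
    * (1 + 8 * (131072 * ((d : ℝ) + 1) ^ 2) * ((L : ℝ) ^ k * b)) ≤ 2)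
  (hc₃ : 4 * ((L : ℝ) ^ k * b) < c3 d L)
  (h145 : 8 * d * thetaGen d L α₀ * (L : ℝ)⁻¹ ^ 4 ≤ 1)
  (h155 : (2 * (L : ℝ) - 1) * (L : ℝ)⁻¹ ^ 2 + 2 * d * thetaGen d L α₀ * (L : ℝ)⁻¹ ^ 3
    + 1 / 8 * (1 + 2 * d * thetaGen d L α₀ * (L : ℝ)⁻¹ ^ 2 + 2 * d * C3Gen d L * ((L : ℝ) ^ k * b)) * (L : ℝ)⁻¹ ^ 2 ≤ 1)

/-- The per-entry constant at `j = k` (`(Lʲ/Lᵏ)² = 1`). [folklore] -/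
private theorem entry_const_eq' (hL : 2 ≤ L) :
    ((1 + thetaGen d L α₀ * ((L : ℝ) ^ k * ((L : ℝ) ^ k)⁻¹) ^ 2) * (L : ℝ) ^ k + C3Gen d L * ((L : ℝ) ^ k) ^ 2 * b)
        * (((L : ℝ) ^ k) ^ d)⁻¹
      = ((1 + thetaGen d L α₀) * (L : ℝ) ^ k + C3Gen d L * ((L : ℝ) ^ k) ^ 2 * b) * (((L : ℝ) ^ k) ^ d)⁻¹ := by
  have hL0 : (L : ℝ) ≠ 0 := by exact_mod_cast (show L ≠ 0 by omega)
  rw [mul_inv_cancel₀ (pow_ne_zero _ hL0), one_pow, mul_one]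

/-! ## §1 Clause (ii) at a curved background: the two-sided one-bond Lipschitz bound -/

include hL hG hU₀ hα hα3 hα4 h52 hb hsmall hc₃ h145 h155 in
/-- **TWO-SIDED ONE-BOND LIPSCHITZ BOUND FOR `Q_k(U₀, ·)` AT A GENERAL REGULAR BACKGROUND** — clause (ii) of `FramedBondLip`
on `ℤ^d`, logarithmic coordinates, curved background: for `B, B′` in p06's polydisc (`sup ‖·‖ ≤ b` with the displayed regime)
agreeing off ONE fine bond `⟨y, y+e_μ⟩`, every `k`-fold averaged logarithmic bond variable moves by at most
`((1 + θ)L^k + C₃(L^k)²b)·L^{−kd}·‖B′_{yμ} − B_{yμ}‖` — p06's per-bond line derivative (156)@gen (`prop5_general_156` at `j = k`)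
integrated along `t ∈ [0,1] ↦ B + t·(B′ − B)`, inside the polydisc by convexity of the sup-ball. [cite: Balaban1985Averaging, Prop. 5 (156) p.42, (137)–(138) p.39] -/
theorem norm_logCovIter_sub_le_one_bond (B B' : Site d → Fin d → 𝔸) (hB : ∀ x κ, ‖B x κ‖ ≤ b)
    (hB' : ∀ x κ, ‖B' x κ‖ ≤ b) (y : Site d) (μ : Fin d) (hagree : ∀ x κ, ¬(x = y ∧ κ = μ) → B x κ = B' x κ)
    (z : Site d) (κ : Fin d) :
    ‖logCovIter L U₀ B' k z κ - logCovIter L U₀ B k z κ‖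
      ≤ ((1 + thetaGen d L α₀) * (L : ℝ) ^ k + C3Gen d L * ((L : ℝ) ^ k) ^ 2 * b) * (((L : ℝ) ^ k) ^ d)⁻¹
          * ‖B' y μ - B y μ‖ := by
  set X : 𝔸 := B' y μ - B y μ with hXdef
  set D : Site d → Fin d → 𝔸 := bump y μ X with hD
  have hBB' : B' = B + D := by
    rw [hD, hXdef]; exact eq_add_bump_of_agree_off_bond B B' y μ hagree
  set Φ : ℂ → 𝔸 := fun τ => logCovIter L U₀ (B + τ • D) k z κ with hΦ
  set F' : ℝ → 𝔸 := fun t => dCov L U₀ (B + (t : ℂ) • D) D k z κ + linCovIter L U₀ D k z κ with hF'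
  have hpoly : ∀ t : ℝ, t ∈ Icc (0 : ℝ) 1 → ∀ x κ', ‖(B + (t : ℂ) • D) x κ'‖ ≤ b := by
    intro t ht x κ'
    simp only [Pi.add_apply, Pi.smul_apply, hD, bump]
    split_ifs with h
    · obtain ⟨rfl, rfl⟩ := h
      have hconv : B x κ' + (t : ℂ) • X = ((1 - t : ℝ) : ℂ) • B x κ' + (t : ℂ) • B' x κ' := by
        rw [hXdef, smul_sub, Complex.ofReal_sub, Complex.ofReal_one, sub_smul, one_smul]
        abel
      rw [hconv]
      calc ‖((1 - t : ℝ) : ℂ) • B x κ' + (t : ℂ) • B' x κ'‖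
          ≤ ‖((1 - t : ℝ) : ℂ) • B x κ'‖ + ‖(t : ℂ) • B' x κ'‖ := norm_add_le _ _
        _ = (1 - t) * ‖B x κ'‖ + t * ‖B' x κ'‖ := by
            rw [norm_smul, norm_smul, Complex.norm_real, Complex.norm_real, Real.norm_eq_abs, Real.norm_eq_abs,
              abs_of_nonneg (by linarith [ht.2]), abs_of_nonneg ht.1]
        _ ≤ (1 - t) * b + t * b := add_le_add (mul_le_mul_of_nonneg_left (hB x κ') (by linarith [ht.2]))
            (mul_le_mul_of_nonneg_left (hB' x κ') ht.1)
        _ = b := by ring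
    · rw [smul_zero, add_zero]; exact hB x κ'
  have hderC : ∀ t : ℝ, t ∈ Icc (0 : ℝ) 1 →
      HasDerivAt Φ (F' t) (t : ℂ) ∧
        ‖F' t‖ ≤ ((1 + thetaGen d L α₀) * (L : ℝ) ^ k + C3Gen d L * ((L : ℝ) ^ k) ^ 2 * b)
          * (((L : ℝ) ^ k) ^ d)⁻¹ * ‖X‖ := by
    intro t ht
    obtain ⟨h1, h2⟩ := prop5_general_156 L hL hG k U₀ hU₀ hα hα3 hα4 h52 (B + (t : ℂ) • D) hb (hpoly t ht) hsmall hc₃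
      h145 h155 y μ X le_rfl z κ
    rw [entry_const_eq' L k hL] at h2
    refine ⟨hasDerivAt_of_shift ?_, h2⟩
    have h1' : HasDerivAt (fun τ : ℂ => logCovIter L U₀ (B + (t : ℂ) • D + τ • D) k z κ) (F' t) 0 := h1
    refine h1'.congr_of_eventuallyEq (Filter.Eventually.of_forall fun τ => ?_)
    show Φ ((t : ℂ) + τ) = logCovIter L U₀ (B + (t : ℂ) • D + τ • D) k z κ
    simp only [hΦ, add_smul, add_assoc]
  have hderR : ∀ t ∈ Icc (0 : ℝ) 1, HasDerivWithinAt (fun s : ℝ => Φ (s : ℂ)) (F' t) (Icc (0 : ℝ) 1) t :=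
    fun t ht => (hasDerivAt_comp_ofReal (hderC t ht).1).hasDerivWithinAt
  have hmv := norm_image_sub_le_of_norm_deriv_le_segment_01' hderR
    (fun t ht => (hderC t (Ico_subset_Icc_self ht)).2)
  have h1 : Φ ((1 : ℝ) : ℂ) = logCovIter L U₀ B' k z κ := by
    simp only [hΦ, Complex.ofReal_one, one_smul, hBB']
  have h0 : Φ ((0 : ℝ) : ℂ) = logCovIter L U₀ B k z κ := by
    simp only [hΦ, Complex.ofReal_zero, zero_smul, add_zero]
  rw [h1, h0] at hmv
  exact hmv

omit [NormOneClass 𝔸] in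
/-- LOCALITY, two-sided form at a general background (`B7LocalityGeneral.logCovIter_congr`): two bond fields agreeing off a fine
bond NOT contained in the box of the coarse bond `c` have the same `Q_k(U₀, ·)(c)`. [cite: Balaban1985Averaging, p.24 (after (43)), p.31 (after (91))] -/
theorem logCovIter_eq_of_agree_off_bond_not_bondIn (hL1 : 1 ≤ L) (B B' : Site d → Fin d → 𝔸) (y : Site d) (μ : Fin d)
    (hagree : ∀ x κ, ¬(x = y ∧ κ = μ) → B x κ = B' x κ) (z : Site d) (κ : Fin d)
    (hnot : ¬ BondIn (loK L k z) (bondHiK L k z κ) y μ) :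
    logCovIter L U₀ B' k z κ = logCovIter L U₀ B k z κ := by
  rw [eq_add_bump_of_agree_off_bond B B' y μ hagree]
  exact logCovIter_add_bump_eq_of_not_bondIn L k U₀ hL1 B y μ _ z κ hnot

/-! ## §2 The printed normalisation: (156) + (138) summed at a general background -/

variable (A : Site d → Fin d → 𝔸) {a : ℝ} (ha : 0 ≤ a) (hA : ∀ x κ, ‖A x κ‖ ≤ a)
  (hsmallA : Real.exp (4 * (800 * ((d : ℝ) + 1) ^ 2 * ((d : ℝ) + 4)) * α₀)
    * (1 + 8 * (131072 * ((d : ℝ) + 1) ^ 2) * a) ≤ 2)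
  (hc₃A : 4 * a < c3 d L)
  (h155A : (2 * (L : ℝ) - 1) * (L : ℝ)⁻¹ ^ 2 + 2 * d * thetaGen d L α₀ * (L : ℝ)⁻¹ ^ 3
    + 1 / 8 * (1 + 2 * d * thetaGen d L α₀ * (L : ℝ)⁻¹ ^ 2 + 2 * d * C3Gen d L * a) * (L : ℝ)⁻¹ ^ 2 ≤ 1)

include hL hG hU₀ hα hα3 hα4 h52 ha hA hsmallA hc₃A h145 h155A in
/-- **(156) SUMMED AT A GENERAL REGULAR BACKGROUND, PRINTED VARIABLES** (`η = L^{−k}`, `sup_b |A_b| ≤ a`, p06's printed-variable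
smallness of `B7Prop5General` §4, `A` vanishing off `Λ`): `‖Q_k(U₀, ηA)(c)‖ ≤ (1 + 2C′₁α₀ + C₃a) · Σ_{b∈Λ} η^d ‖A_b‖`
(`2C′₁α₀` = `thetaGen d L α₀`) — the printed per-entry constant «1 + 2C′₁α₀ + C₃|A|» of (156) p. 42 times the `η^d`-weighted
ℓ¹ norm of `A`, which is (138)'s `Σ_b η^d tr(δF∕δA_b · δA_b)` integrated from the background. [cite: Balaban1985Averaging, Prop. 5 (156) p.42, (138) p.39] -/
theorem norm_logCovIter_le_l1_printed (Λ : Finset (Site d × Fin d)) (hoff : ∀ x κ, (x, κ) ∉ Λ → A x κ = 0)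
    (z : Site d) (κ : Fin d) :
    ‖logCovIter L U₀ ((((L : ℝ) ^ k)⁻¹) • A) k z κ‖
      ≤ (1 + thetaGen d L α₀ + C3Gen d L * a) * ∑ s ∈ Λ, (((L : ℝ) ^ k)⁻¹) ^ d * ‖A s.1 s.2‖ := by
  have hL1 : 1 ≤ L := le_trans (by norm_num) hL
  have hL0 : (0 : ℝ) < L := by exact_mod_cast (show 0 < L from hL1)
  set η : ℝ := ((L : ℝ) ^ k)⁻¹ with hη
  have hη0 : 0 < η := by positivity
  have hLη : (L : ℝ) ^ k * η = 1 := mul_inv_cancel₀ (by positivity)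
  have hB : ∀ x κ', ‖(η • A) x κ'‖ ≤ η * a := fun x κ' => by
    rw [Pi.smul_apply, Pi.smul_apply, norm_real_smul η hη0.le]
    exact mul_le_mul_of_nonneg_left (hA x κ') hη0.le
  have hoffB : ∀ x κ', (x, κ') ∉ Λ → (η • A) x κ' = 0 := fun x κ' hx => by
    rw [Pi.smul_apply, Pi.smul_apply, hoff x κ' hx, smul_zero]
  have e : (L : ℝ) ^ k * (η * a) = a := by rw [← mul_assoc, hLη, one_mul]
  have hsmall' : Real.exp (4 * (800 * ((d : ℝ) + 1) ^ 2 * ((d : ℝ) + 4)) * α₀)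
      * (1 + 8 * (131072 * ((d : ℝ) + 1) ^ 2) * ((L : ℝ) ^ k * (η * a))) ≤ 2 := by rw [e]; exact hsmallA
  have hc₃' : 4 * ((L : ℝ) ^ k * (η * a)) < c3 d L := by rw [e]; exact hc₃A
  have h155' : (2 * (L : ℝ) - 1) * (L : ℝ)⁻¹ ^ 2 + 2 * d * thetaGen d L α₀ * (L : ℝ)⁻¹ ^ 3
      + 1 / 8 * (1 + 2 * d * thetaGen d L α₀ * (L : ℝ)⁻¹ ^ 2 + 2 * d * C3Gen d L * ((L : ℝ) ^ k * (η * a)))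
        * (L : ℝ)⁻¹ ^ 2 ≤ 1 := by rw [e]; exact h155A
  have h := norm_logCovIter_le_l1 L hL hG k U₀ hU₀ hα hα3 hα4 h52 (by positivity) hsmall' hc₃' h145 h155' Λ (η • A)
    hB hoffB z κ
  refine h.trans (le_of_eq ?_)
  rw [Finset.mul_sum, Finset.mul_sum]
  refine Finset.sum_congr rfl fun s _ => ?_
  rw [Pi.smul_apply, Pi.smul_apply, norm_real_smul η hη0.le, ← inv_pow, ← hη]
  have : (L : ℝ) ^ k * η = 1 := hLη
  calc ((1 + thetaGen d L α₀) * (L : ℝ) ^ k + C3Gen d L * ((L : ℝ) ^ k) ^ 2 * (η * a)) * η ^ d * (η * ‖A s.1 s.2‖)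
      = ((1 + thetaGen d L α₀) * ((L : ℝ) ^ k * η) + C3Gen d L * a * ((L : ℝ) ^ k * η) ^ 2) * (η ^ d * ‖A s.1 s.2‖) := by
        ring
    _ = (1 + thetaGen d L α₀ + C3Gen d L * a) * (η ^ d * ‖A s.1 s.2‖) := by rw [this, one_pow, mul_one, mul_one]

end Regime

end Summit.QuantumFields.BalabanUV.T4Continuum.Spine.NE7.B7Curved

end
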